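import Summits.AnomalousDissipation.AnomalousDissipation.Theorems.MarginalStabilityChainStrainedLayerLawClockSecondMomentLawTools
import HarnessLib

/-!
# Crux `MarginalStabilityChain.StrainedLayerLaw` (stmt-AnomalousDissipation-3007), line `FirstLemmasR2K4`
# (log-enstrophy clock + Nash roundness): the second-moment / Reynolds-stress law

Support file (`--supports stmt-AnomalousDissipation-3007`; registered sub-goal `secondMoment_law` of line
`FirstLemmasR2K4`, lead c7, wave 2).

What it proves: along every classical solution `(u, v, p)` of the stretched two-dimensional Navier–Stokes layer
class on `(0, ∞)` (`ν, L > 0`, normalisation `γ = ΔU = 1`) with shear tails on every compact time interval, the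
second `y`-moment of the vorticity over one period strip, `I₂(τ) = ∫_{x ∈ (0,L]} ∫_y y² ω(τ, x, y)`
(`ω = ∂ₓv − ∂_yu`), obeys the EXACT law
`I₂(t) − I₂(s) = ∫_s^t (−2 I₂(τ) + 2 Π(τ) − 2νL) dτ` (`0 < s ≤ t`), `Π(τ) = ∫_{x ∈ (0,L]} ∫_y u v` the Reynolds
stress of the period strip. Formally `I₂′ = ∫∫ y²(−U·∇ω + ω + νΔω)` with `U = (u, v − y)`: transport
`∫∫ ω U·∇(y²) = 2∫∫ yvω − 3I₂`, stretching `+I₂`, viscosity `2ν∫∫ ω`; and `∫∫ yvω = ∫∫ uv` (integrations by parts,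
`div (u, v) = 0`), `∫∫ ω = −L` (the circulation of one period). In the time mean `⟨Π⟩ = ⟨I₂⟩ + νL`.

Route (rigorous, cutoff in `y`; the machine of wave 1, `…ClockCentroidLaw{,Tools}.lean`, and the slice identities
and weight of `…ClockSecondMomentLawTools.lean`): with the weight
`ψ_R(y) = y · (y σ(2 − y/R) σ(2 + y/R))` (`σ` = `Real.smoothTransition`; `C¹`, `= 0` for `|y| ≥ 2R`, `|ψ_R| ≤ 4R²`,
`|ψ_R′| ≤ (2 + 4C_σ)|y|`, `ψ_R(y) = y²`, `ψ_R′(y) = 2y` once `R > |y|`) the general derivative formula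
`centroidLaw_hasDerivAt` gives `N_R′ = B_R − νE_R` on `τ > 0` (`N_R = ∫∫ ωψ_R`, `B_R = ∫∫ ω(v − y)ψ_R′`,
`E_R = ∫∫ ∂_yω ψ_R′`); the fundamental theorem of calculus on `[s, t]`; then `R → ∞` by dominated convergence on
the strip at each instant (`N_R → I₂`, `B_R → 2∫∫ yvω − 2I₂ = 2Π − 2I₂`, `E_R → 2∫∫ y∂_yω = −2∫∫ ω = 2L`, majorants
`const · (1 + |y|)²e^{−k|y|}`) and in time (majorants uniform on `[s, t]`); finally the strip integrals are the
line's iterated integrals (Fubini). All `[folklore]` (moment laws of 2-D vorticity dynamics in a strain: e.g. Majda–Bertozzi,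
*Vorticity and Incompressible Flow*, CUP 2002, §1.4; Reynolds-stress bookkeeping of the temporal mixing layer).
-/

-- `Summit.<Summit>.<Problem>` is the tree's mandated summit-side namespace (CONVENTIONS §2); for this
-- single-conjunct summit the two coincide, so the duplicate is deliberate.
set_option linter.dupNamespace false

noncomputable section

open scoped Topology ENNReal
open Filter Set Function MeasureTheory

namespace Summit.AnomalousDissipation.AnomalousDissipation.Theorems.StrainedLayerLaw.LogEnstrophyClock

open Literature.Analysis.FluidPDE Literature.Analysis.FluidPDE.StretchedLayer
open Summit.AnomalousDissipation.AnomalousDissipation.Theses.MarginalStabilityChain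
open Summit.AnomalousDissipation.AnomalousDissipation.Theorems.StrainedLayerLaw.StrainWorkSumRule

/-! ## The limits `R → ∞` at one instant -/

section Limits

variable {L C k : ℝ} {f g : ℝ → ℝ → ℝ}

/-- `|ωψ_R| ≤ C(1 + |y|)²e^{−k|y|}`. [folklore] -/
theorem secondMoment_N_bound (hT : SliceTails C k f g) (R : ℝ) (q : ℝ × ℝ) :
    |vorticity f g q.1 q.2 *
        (q.2 * (q.2 * (Real.smoothTransition (2 - q.2 / R) * Real.smoothTransition (2 + q.2 / R))))| ≤
      C * ((1 + |q.2|) ^ 2 * Real.exp (-k * |q.2|)) := by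
  have hC : 0 ≤ C := hT.nonneg
  have h1 := tails_abs_vorticity_le hT q.1 q.2
  have h2 : |q.2 * (q.2 * (Real.smoothTransition (2 - q.2 / R) * Real.smoothTransition (2 + q.2 / R)))| ≤
      (1 + |q.2|) ^ 2 := by
    rw [abs_mul]
    have h3 := centroidLaw_weight_abs_le R q.2
    have h4 := abs_nonneg (q.2 * (Real.smoothTransition (2 - q.2 / R) * Real.smoothTransition (2 + q.2 / R)))
    nlinarith [abs_nonneg q.2]
  rw [abs_mul]
  calc _ ≤ C * Real.exp (-k * |q.2|) * (1 + |q.2|) ^ 2 := mul_le_mul h1 h2 (abs_nonneg _) (by positivity)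
    _ = C * ((1 + |q.2|) ^ 2 * Real.exp (-k * |q.2|)) := by ring

/-- `|ω(v − y)ψ_R′| ≤ (2 + 4C_σ)C(C + 1)(1 + |y|)²e^{−k|y|}` (`R > 0`). [folklore] -/
theorem secondMoment_B_bound (hk : 0 < k) (hT : SliceTails C k f g) {R : ℝ} (hR : 0 < R) {Cσ : ℝ}
    (hCσ0 : 0 ≤ Cσ) (hCσ : ∀ x, |deriv Real.smoothTransition x| ≤ Cσ) (q : ℝ × ℝ) :
    |vorticity f g q.1 q.2 * (g q.1 q.2 - q.2) * deriv (fun y : ℝ =>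
        y * (y * (Real.smoothTransition (2 - y / R) * Real.smoothTransition (2 + y / R)))) q.2| ≤
      (2 + 4 * Cσ) * (C * (C + 1)) * ((1 + |q.2|) ^ 2 * Real.exp (-k * |q.2|)) := by
  have hC : 0 ≤ C := hT.nonneg
  have h1 := tails_abs_vorticity_le hT q.1 q.2
  have h2 : |g q.1 q.2 - q.2| ≤ C + |q.2| := by
    have h5 := hT.abs_v_le_const hk q.1 q.2
    have h6 := abs_sub (g q.1 q.2) q.2
    linarith
  have h3 := secondMoment_weight_deriv_abs_le hR hCσ0 hCσ q.2
  have h4 : (C + |q.2|) * |q.2| ≤ (C + 1) * (1 + |q.2|) ^ 2 := by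
    nlinarith [mul_nonneg hC (abs_nonneg q.2), mul_nonneg hC (sq_nonneg |q.2|), abs_nonneg q.2, sq_nonneg |q.2|]
  have he := (Real.exp_pos (-k * |q.2|)).le
  rw [abs_mul, abs_mul]
  calc _ ≤ C * Real.exp (-k * |q.2|) * (C + |q.2|) * ((2 + 4 * Cσ) * |q.2|) :=
        mul_le_mul (mul_le_mul h1 h2 (abs_nonneg _) (by positivity)) h3 (abs_nonneg _) (by positivity)
    _ = (2 + 4 * Cσ) * C * ((C + |q.2|) * |q.2|) * Real.exp (-k * |q.2|) := by ring
    _ ≤ (2 + 4 * Cσ) * C * ((C + 1) * (1 + |q.2|) ^ 2) * Real.exp (-k * |q.2|) := by gcongr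
    _ = (2 + 4 * Cσ) * (C * (C + 1)) * ((1 + |q.2|) ^ 2 * Real.exp (-k * |q.2|)) := by ring

/-- `|∂_yω ψ_R′| ≤ (2 + 4C_σ)C(1 + |y|)²e^{−k|y|}` (`R > 0`). [folklore] -/
theorem secondMoment_E_bound (hT : SliceTails C k f g) (hf : ContDiff ℝ 2 (fun q : ℝ × ℝ => f q.1 q.2))
    (hg : ContDiff ℝ 2 (fun q : ℝ × ℝ => g q.1 q.2)) (hdiv : ∀ x y, dX f x y + dY g x y = 0)
    {R : ℝ} (hR : 0 < R) {Cσ : ℝ} (hCσ0 : 0 ≤ Cσ) (hCσ : ∀ x, |deriv Real.smoothTransition x| ≤ Cσ) (q : ℝ × ℝ) :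
    |1 * dY (vorticity f g) q.1 q.2 * deriv (fun y : ℝ =>
        y * (y * (Real.smoothTransition (2 - y / R) * Real.smoothTransition (2 + y / R)))) q.2| ≤
      (2 + 4 * Cσ) * C * ((1 + |q.2|) ^ 2 * Real.exp (-k * |q.2|)) := by
  have hC : 0 ≤ C := hT.nonneg
  have h1 := kato_abs_dY_vorticity_le hT hf hg hdiv q.1 q.2
  have h3 := secondMoment_weight_deriv_abs_le hR hCσ0 hCσ q.2
  have hy : |q.2| ≤ (1 + |q.2|) ^ 2 := by nlinarith [abs_nonneg q.2]
  have he := (Real.exp_pos (-k * |q.2|)).le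
  rw [one_mul, abs_mul]
  calc _ ≤ C * Real.exp (-k * |q.2|) * ((2 + 4 * Cσ) * |q.2|) := mul_le_mul h1 h3 (abs_nonneg _) (by positivity)
    _ = (2 + 4 * Cσ) * C * |q.2| * Real.exp (-k * |q.2|) := by ring
    _ ≤ (2 + 4 * Cσ) * C * (1 + |q.2|) ^ 2 * Real.exp (-k * |q.2|) := by gcongr
    _ = (2 + 4 * Cσ) * C * ((1 + |q.2|) ^ 2 * Real.exp (-k * |q.2|)) := by ring

/-- **`N_R = ∫∫ ωψ_R → I₂ = ∫∫ y²ω`** as `R → ∞` (dominated convergence, `ψ_R(y) = y²` once `R > |y|`).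
[folklore] -/
theorem secondMoment_limit_N (hk : 0 < k) (hT : SliceTails C k f g)
    (hf : ContDiff ℝ 2 (fun q : ℝ × ℝ => f q.1 q.2)) (hg : ContDiff ℝ 2 (fun q : ℝ × ℝ => g q.1 q.2)) :
    Tendsto (fun R : ℝ => ∫ q in Ioc 0 L ×ˢ univ, vorticity f g q.1 q.2 *
      (q.2 * (q.2 * (Real.smoothTransition (2 - q.2 / R) * Real.smoothTransition (2 + q.2 / R))))) atTop
      (𝓝 (∫ q in Ioc 0 L ×ˢ univ, q.2 ^ 2 * vorticity f g q.1 q.2)) := by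
  have cω : Continuous fun q : ℝ × ℝ => vorticity f g q.1 q.2 := (contDiff_one_vorticity hf hg).continuous
  refine tendsto_integral_filter_of_dominated_convergence
    (fun q => C * ((1 + |q.2|) ^ 2 * Real.exp (-k * |q.2|))) ?_ ?_ ?_ ?_
  · exact Eventually.of_forall fun R =>
      (cω.mul ((secondMoment_weight_contDiff R).continuous.comp continuous_snd)).aestronglyMeasurable
  · exact Eventually.of_forall fun R => Eventually.of_forall fun q => by
      rw [Real.norm_eq_abs]; exact secondMoment_N_bound hT R q
  · exact (secondMoment_integrableOn_weight hk L).const_mul C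
  · refine Eventually.of_forall fun q => tendsto_const_nhds.congr' ?_
    filter_upwards [secondMoment_weight_eventually q.2] with R hR
    rw [hR.1, mul_comm]

/-- **`B_R = ∫∫ ω(v − y)ψ_R′ → 2∫∫ yvω − 2∫∫ y²ω = 2∫∫ uv − 2I₂`** as `R → ∞` (dominated convergence with
`ψ_R′ → 2y`, `|ψ_R′| ≤ (2 + 4C_σ)|y|`; `∫∫ yvω = ∫∫ uv`). [folklore] -/
theorem secondMoment_limit_B (hL : 0 < L) (hk : 0 < k) (hT : SliceTails C k f g)
    (hf : ContDiff ℝ 2 (fun q : ℝ × ℝ => f q.1 q.2)) (hg : ContDiff ℝ 2 (fun q : ℝ × ℝ => g q.1 q.2))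
    (hdiv : ∀ x y, dX f x y + dY g x y = 0) (hfper : ∀ x y, f (x + L) y = f x y)
    (hgper : ∀ x y, g (x + L) y = g x y) {Cσ : ℝ} (hCσ0 : 0 ≤ Cσ)
    (hCσ : ∀ x, |deriv Real.smoothTransition x| ≤ Cσ) :
    Tendsto (fun R : ℝ => ∫ q in Ioc 0 L ×ˢ univ, vorticity f g q.1 q.2 * (g q.1 q.2 - q.2) *
      deriv (fun y : ℝ => y * (y * (Real.smoothTransition (2 - y / R) * Real.smoothTransition (2 + y / R)))) q.2)
      atTop (𝓝 (2 * (∫ q in Ioc 0 L ×ˢ univ, f q.1 q.2 * g q.1 q.2) -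
        2 * ∫ q in Ioc 0 L ×ˢ univ, q.2 ^ 2 * vorticity f g q.1 q.2)) := by
  have hC : 0 ≤ C := hT.nonneg
  have cω : Continuous fun q : ℝ × ℝ => vorticity f g q.1 q.2 := (contDiff_one_vorticity hf hg).continuous
  have cg : Continuous fun q : ℝ × ℝ => g q.1 q.2 := hg.continuous
  have i1 : IntegrableOn (fun q : ℝ × ℝ => q.2 * g q.1 q.2 * vorticity f g q.1 q.2) (Ioc 0 L ×ˢ univ) :=
    integrableOn_strip_of_abs_le_sq_exp (C := C * C) ((continuous_snd.mul cg).mul cω) hk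
      fun x _ y => secondMoment_bookkeeping (hT.abs_v_le_const hk x y) (tails_abs_vorticity_le hT x y)
  have i2 := secondMoment_integrableOn_sqMoment (L := L) hk hT hf hg
  have e : ∫ q in Ioc 0 L ×ˢ univ, vorticity f g q.1 q.2 * (g q.1 q.2 - q.2) * (2 * q.2) =
      2 * (∫ q in Ioc 0 L ×ˢ univ, f q.1 q.2 * g q.1 q.2) -
        2 * ∫ q in Ioc 0 L ×ˢ univ, q.2 ^ 2 * vorticity f g q.1 q.2 := by
    calc ∫ q in Ioc 0 L ×ˢ univ, vorticity f g q.1 q.2 * (g q.1 q.2 - q.2) * (2 * q.2)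
        = ∫ q in Ioc 0 L ×ˢ univ, (2 * (q.2 * g q.1 q.2 * vorticity f g q.1 q.2) -
            2 * (q.2 ^ 2 * vorticity f g q.1 q.2)) :=
          integral_congr_ae (Eventually.of_forall fun q => by simp only; ring)
      _ = 2 * (∫ q in Ioc 0 L ×ˢ univ, q.2 * g q.1 q.2 * vorticity f g q.1 q.2) -
            2 * ∫ q in Ioc 0 L ×ˢ univ, q.2 ^ 2 * vorticity f g q.1 q.2 := by
          rw [integral_sub (i1.const_mul 2) (i2.const_mul 2), integral_const_mul, integral_const_mul]
      _ = _ := by rw [secondMoment_integral_y_v_vorticity hL hk hT hf hg hdiv hfper hgper]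
  have key : Tendsto (fun R : ℝ => ∫ q in Ioc 0 L ×ˢ univ, vorticity f g q.1 q.2 * (g q.1 q.2 - q.2) *
      deriv (fun y : ℝ => y * (y * (Real.smoothTransition (2 - y / R) * Real.smoothTransition (2 + y / R)))) q.2)
      atTop (𝓝 (∫ q in Ioc 0 L ×ˢ univ, vorticity f g q.1 q.2 * (g q.1 q.2 - q.2) * (2 * q.2))) := by
    refine tendsto_integral_filter_of_dominated_convergence
      (fun q => (2 + 4 * Cσ) * (C * (C + 1)) * ((1 + |q.2|) ^ 2 * Real.exp (-k * |q.2|))) ?_ ?_ ?_ ?_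
    · exact Eventually.of_forall fun R => ((cω.mul (cg.sub continuous_snd)).mul
        (((secondMoment_weight_contDiff R).continuous_deriv le_rfl).comp continuous_snd)).aestronglyMeasurable
    · filter_upwards [eventually_gt_atTop 0] with R hR
      exact Eventually.of_forall fun q => by
        rw [Real.norm_eq_abs]; exact secondMoment_B_bound hk hT hR hCσ0 hCσ q
    · exact (secondMoment_integrableOn_weight hk L).const_mul _
    · refine Eventually.of_forall fun q => tendsto_const_nhds.congr' ?_
      filter_upwards [secondMoment_weight_eventually q.2] with R hR
      rw [hR.2]
  rw [e] at key
  exact key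

/-- **`E_R = ∫∫ ∂_yω ψ_R′ → 2∫∫ y∂_yω = 2L`** as `R → ∞` (dominated convergence, `|∂_yω| ≤ Ce^{−k|y|}`).
[folklore] -/
theorem secondMoment_limit_E (hL : 0 ≤ L) (hk : 0 < k) (hT : SliceTails C k f g)
    (hf : ContDiff ℝ 2 (fun q : ℝ × ℝ => f q.1 q.2)) (hg : ContDiff ℝ 2 (fun q : ℝ × ℝ => g q.1 q.2))
    (hdiv : ∀ x y, dX f x y + dY g x y = 0) (hgper : ∀ x y, g (x + L) y = g x y)
    (hft : ∀ x, Tendsto (fun y => f x y) atTop (𝓝 (1 / 2)))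
    (hfb : ∀ x, Tendsto (fun y => f x y) atBot (𝓝 (-(1 / 2)))) {Cσ : ℝ} (hCσ0 : 0 ≤ Cσ)
    (hCσ : ∀ x, |deriv Real.smoothTransition x| ≤ Cσ) :
    Tendsto (fun R : ℝ => ∫ q in Ioc 0 L ×ˢ univ, 1 * dY (vorticity f g) q.1 q.2 *
      deriv (fun y : ℝ => y * (y * (Real.smoothTransition (2 - y / R) * Real.smoothTransition (2 + y / R)))) q.2)
      atTop (𝓝 (2 * L)) := by
  have hC : 0 ≤ C := hT.nonneg
  have cωy : Continuous fun q : ℝ × ℝ => dY (vorticity f g) q.1 q.2 := continuous_dY (contDiff_one_vorticity hf hg)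
  have e : ∫ q in Ioc 0 L ×ˢ univ, 1 * dY (vorticity f g) q.1 q.2 * (2 * q.2) = 2 * L := by
    calc ∫ q in Ioc 0 L ×ˢ univ, 1 * dY (vorticity f g) q.1 q.2 * (2 * q.2)
        = ∫ q in Ioc 0 L ×ˢ univ, 2 * (q.2 * dY (vorticity f g) q.1 q.2) :=
          integral_congr_ae (Eventually.of_forall fun q => by simp only; ring)
      _ = 2 * ∫ q in Ioc 0 L ×ˢ univ, q.2 * dY (vorticity f g) q.1 q.2 := integral_const_mul _ _
      _ = 2 * L := by rw [secondMoment_integral_y_dY_vorticity hL hk hT hf hg hdiv hgper hft hfb]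
  have key : Tendsto (fun R : ℝ => ∫ q in Ioc 0 L ×ˢ univ, 1 * dY (vorticity f g) q.1 q.2 *
      deriv (fun y : ℝ => y * (y * (Real.smoothTransition (2 - y / R) * Real.smoothTransition (2 + y / R)))) q.2)
      atTop (𝓝 (∫ q in Ioc 0 L ×ˢ univ, 1 * dY (vorticity f g) q.1 q.2 * (2 * q.2))) := by
    refine tendsto_integral_filter_of_dominated_convergence
      (fun q => (2 + 4 * Cσ) * C * ((1 + |q.2|) ^ 2 * Real.exp (-k * |q.2|))) ?_ ?_ ?_ ?_
    · exact Eventually.of_forall fun R => ((continuous_const.mul cωy).mul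
        (((secondMoment_weight_contDiff R).continuous_deriv le_rfl).comp continuous_snd)).aestronglyMeasurable
    · filter_upwards [eventually_gt_atTop 0] with R hR
      exact Eventually.of_forall fun q => by
        rw [Real.norm_eq_abs]; exact secondMoment_E_bound hT hf hg hdiv hR hCσ0 hCσ q
    · exact (secondMoment_integrableOn_weight hk L).const_mul _
    · refine Eventually.of_forall fun q => tendsto_const_nhds.congr' ?_
      filter_upwards [secondMoment_weight_eventually q.2] with R hR
      rw [hR.2]
  rw [e] at key
  exact key

end Limits

/-! ## Along the solution: the strip form of the law -/

section Solution

variable {ν L : ℝ} {u v p : ℝ → ℝ → ℝ → ℝ}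

/-- **The second-moment law in strip form** (`0 < s ≤ t`):
`I₂(t) − I₂(s) = ∫_s^t (−2I₂ + 2Π − 2νL)`, `I₂ = ∫∫ y²ω`, `Π = ∫∫ uv` (product-measure integrals over the period
strip): `N_R′ = B_R − νE_R` (`centroidLaw_hasDerivAt` with the weight `ψ_R`), the fundamental theorem of calculus on
`[s, t]`, and `R → ∞` by dominated convergence on the strip at each instant (`N_R → I₂`, `B_R → 2Π − 2I₂`,
`E_R → 2L`) and in time (majorants uniform on `[s, t]`). [folklore] -/
theorem secondMoment_strip_law (hν : 0 ≤ ν) (hL : 0 < L) (hsol : IsStretchedLayerNSSolutionOn (Ioi 0) ν 1 1 L u v p)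
    (htails : ∀ a b : ℝ, 0 < a → a < b → ExpTails (Icc a b) u v) {s t : ℝ} (hs : 0 < s) (hst : s ≤ t) :
    (∫ q in Ioc 0 L ×ˢ univ, q.2 ^ 2 * vorticity (u t) (v t) q.1 q.2) -
        (∫ q in Ioc 0 L ×ˢ univ, q.2 ^ 2 * vorticity (u s) (v s) q.1 q.2) =
      ∫ τ in s..t, (-2 * (∫ q in Ioc 0 L ×ˢ univ, q.2 ^ 2 * vorticity (u τ) (v τ) q.1 q.2) +
        2 * (∫ q in Ioc 0 L ×ˢ univ, u τ q.1 q.2 * v τ q.1 q.2) - 2 * ν * L) := by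
  obtain ⟨C, k, hk, hCk⟩ := htails (s / 2) (t + 1) (by positivity) (by linarith)
  have hST : ∀ τ ∈ Icc s t, SliceTails C k (u τ) (v τ) := fun τ hτ =>
    (hCk τ ⟨by linarith [hτ.1], by linarith [hτ.2]⟩).1
  have hC : 0 ≤ C := (hST s ⟨le_rfl, hst⟩).nonneg
  obtain ⟨Cσ, hCσ0, hCσ⟩ := kato_smoothTransition_deriv_bound
  have hpos : ∀ {τ : ℝ}, τ ∈ Icc s t → 0 < τ := fun hτ => hs.trans_le hτ.1
  have hu2 : ∀ {τ : ℝ}, 0 < τ → ContDiff ℝ 2 (fun q : ℝ × ℝ => u τ q.1 q.2) := fun hτ =>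
    hsol.contDiff_u (mem_Ioi.2 hτ)
  have hv2 : ∀ {τ : ℝ}, 0 < τ → ContDiff ℝ 2 (fun q : ℝ × ℝ => v τ q.1 q.2) := fun hτ =>
    hsol.contDiff_v (mem_Ioi.2 hτ)
  have hdiv : ∀ {τ : ℝ}, 0 < τ → ∀ x y, dX (u τ) x y + dY (v τ) x y = 0 := fun hτ => hsol.divFree _ (mem_Ioi.2 hτ)
  have huper : ∀ {τ : ℝ}, 0 < τ → ∀ x y, u τ (x + L) y = u τ x y := fun hτ => hsol.periodic_u _ (mem_Ioi.2 hτ)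
  have hvper : ∀ {τ : ℝ}, 0 < τ → ∀ x y, v τ (x + L) y = v τ x y := fun hτ => hsol.periodic_v _ (mem_Ioi.2 hτ)
  have hut : ∀ {τ : ℝ}, 0 < τ → ∀ x, Tendsto (fun y => u τ x y) atTop (𝓝 (1 / 2)) := fun hτ =>
    hsol.tendsto_u_atTop _ (mem_Ioi.2 hτ)
  have hub : ∀ {τ : ℝ}, 0 < τ → ∀ x, Tendsto (fun y => u τ x y) atBot (𝓝 (-(1 / 2))) := fun hτ =>
    hsol.tendsto_u_atBot _ (mem_Ioi.2 hτ)
  have hIsub : uIoc s t ⊆ Ioi 0 := fun τ hτ => by rw [uIoc_of_le hst] at hτ; exact hs.trans hτ.1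
  have hsub : uIcc s t ⊆ Ioi 0 := fun τ hτ => by rw [uIcc_of_le hst] at hτ; exact hs.trans_le hτ.1
  -- the weight and the functionals
  set W : ℝ := ∫ q in Ioc 0 L ×ˢ univ, (1 + |q.2|) ^ 2 * Real.exp (-k * |q.2|) with hW
  set ψ : ℝ → ℝ → ℝ := fun R y =>
    y * (y * (Real.smoothTransition (2 - y / R) * Real.smoothTransition (2 + y / R))) with hψ
  set N : ℝ → ℝ → ℝ := fun R τ => ∫ q in Ioc 0 L ×ˢ univ, vorticity (u τ) (v τ) q.1 q.2 * ψ R q.2 with hN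
  set B : ℝ → ℝ → ℝ := fun R τ => ∫ q in Ioc 0 L ×ˢ univ, vorticity (u τ) (v τ) q.1 q.2 * (v τ q.1 q.2 - q.2) *
    deriv (ψ R) q.2 with hB
  set E : ℝ → ℝ → ℝ := fun R τ => ∫ q in Ioc 0 L ×ˢ univ, 1 * dY (vorticity (u τ) (v τ)) q.1 q.2 *
    deriv (ψ R) q.2 with hE
  set M : ℝ → ℝ := fun τ => ∫ q in Ioc 0 L ×ˢ univ, q.2 ^ 2 * vorticity (u τ) (v τ) q.1 q.2 with hM
  set P : ℝ → ℝ := fun τ => ∫ q in Ioc 0 L ×ˢ univ, u τ q.1 q.2 * v τ q.1 q.2 with hP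
  -- (1) the derivative of `N R` (`R > 0`) and continuity of the functionals on `(0, ∞)`
  have hder : ∀ R, 0 < R → ∀ τ, 0 < τ → HasDerivAt (N R) (B R τ - ν * E R τ) τ := fun R hR τ hτ =>
    centroidLaw_hasDerivAt hsol hL (secondMoment_weight_contDiff R) (by positivity : (0:ℝ) < 2 * R * (2 * R))
      (secondMoment_weight_abs_le hR) (fun y hy => secondMoment_weight_eq_zero hR hy) hτ
  have hψ'c : ∀ R, Continuous (deriv (ψ R)) := fun R => (secondMoment_weight_contDiff R).continuous_deriv le_rfl
  have hψ'0 : ∀ R, 0 < R → ∀ y, 2 * R + 1 ≤ |y| → deriv (ψ R) y = 0 := fun R hR y hy =>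
    secondMoment_weight_deriv_eq_zero hR (by linarith)
  have hBc : ∀ R, 0 < R → ContinuousOn (B R) (Ioi 0) := fun R hR =>
    clock_continuousOn_B hsol.contDiffOn_u hsol.contDiffOn_v (F := fun r => r) continuous_id (hψ'c R)
      (hψ'0 R hR) L
  have hEc : ∀ R, 0 < R → ContinuousOn (E R) (Ioi 0) := fun R hR =>
    clock_continuousOn_E hsol.contDiffOn_u hsol.contDiffOn_v (F' := fun _ => (1:ℝ)) continuous_const (hψ'c R)
      (hψ'0 R hR) L
  have hGc : ∀ R, 0 < R → ContinuousOn (fun τ => B R τ - ν * E R τ) (Ioi 0) := fun R hR =>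
    (hBc R hR).sub (continuousOn_const.mul (hEc R hR))
  -- (2) the fundamental theorem of calculus for `N R` on `[s, t]`
  have hFTC : ∀ R, 0 < R → N R t - N R s = ∫ τ in s..t, (B R τ - ν * E R τ) := fun R hR => by
    rw [intervalIntegral.integral_eq_sub_of_hasDerivAt (fun τ hτ => hder R hR τ (hsub hτ))
      (((hGc R hR).mono hsub).intervalIntegrable)]
  -- (3) the limits `R → ∞` at each instant of `[s, t]`
  have hNlim : ∀ {τ : ℝ}, τ ∈ Icc s t → Tendsto (fun R => N R τ) atTop (𝓝 (M τ)) := fun hτ =>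
    secondMoment_limit_N hk (hST _ hτ) (hu2 (hpos hτ)) (hv2 (hpos hτ))
  have hBlim : ∀ {τ : ℝ}, τ ∈ Icc s t → Tendsto (fun R => B R τ) atTop (𝓝 (2 * P τ - 2 * M τ)) := fun hτ =>
    secondMoment_limit_B hL hk (hST _ hτ) (hu2 (hpos hτ)) (hv2 (hpos hτ)) (hdiv (hpos hτ)) (huper (hpos hτ))
      (hvper (hpos hτ)) hCσ0 hCσ
  have hElim : ∀ {τ : ℝ}, τ ∈ Icc s t → Tendsto (fun R => E R τ) atTop (𝓝 (2 * L)) := fun hτ =>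
    secondMoment_limit_E hL.le hk (hST _ hτ) (hu2 (hpos hτ)) (hv2 (hpos hτ)) (hdiv (hpos hτ)) (hvper (hpos hτ))
      (hut (hpos hτ)) (hub (hpos hτ)) hCσ0 hCσ
  -- (4) uniform bounds on `[s, t]`
  have hWi := secondMoment_integrableOn_weight hk L
  have hBb : ∀ {R τ : ℝ}, 0 < R → τ ∈ Icc s t → |B R τ| ≤ (2 + 4 * Cσ) * (C * (C + 1)) * W :=
      fun {R τ} hR hτ => by
    rw [← Real.norm_eq_abs, hW, ← integral_const_mul]
    exact norm_integral_le_of_norm_le (hWi.const_mul _)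
      (Eventually.of_forall fun q => by rw [Real.norm_eq_abs]; exact secondMoment_B_bound hk (hST τ hτ) hR hCσ0 hCσ q)
  have hEb : ∀ {R τ : ℝ}, 0 < R → τ ∈ Icc s t → |E R τ| ≤ (2 + 4 * Cσ) * C * W := fun {R τ} hR hτ => by
    rw [← Real.norm_eq_abs, hW, ← integral_const_mul]
    exact norm_integral_le_of_norm_le (hWi.const_mul _)
      (Eventually.of_forall fun q => by
        rw [Real.norm_eq_abs]
        exact secondMoment_E_bound (hST τ hτ) (hu2 (hpos hτ)) (hv2 (hpos hτ)) (hdiv (hpos hτ)) hR hCσ0 hCσ q)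
  -- (5) dominated convergence in time
  set K : ℝ := (2 + 4 * Cσ) * (C * (C + 1)) * W + ν * ((2 + 4 * Cσ) * C * W) with hK
  have hInt : Tendsto (fun R => ∫ τ in s..t, (B R τ - ν * E R τ)) atTop
      (𝓝 (∫ τ in s..t, (-2 * M τ + 2 * P τ - 2 * ν * L))) := by
    refine intervalIntegral.tendsto_integral_filter_of_dominated_convergence (fun _ => K) ?_ ?_
      intervalIntegrable_const ?_
    · filter_upwards [eventually_gt_atTop 0] with R hR
      exact ((hGc R hR).mono hIsub).aestronglyMeasurable measurableSet_uIoc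
    · filter_upwards [eventually_gt_atTop 0] with R hR
      refine Eventually.of_forall fun τ hτ => ?_
      rw [uIoc_of_le hst] at hτ
      have hτI : τ ∈ Icc s t := ⟨hτ.1.le, hτ.2⟩
      rw [Real.norm_eq_abs]
      calc |B R τ - ν * E R τ| ≤ |B R τ| + |ν * E R τ| := abs_sub _ _
        _ = |B R τ| + ν * |E R τ| := by rw [abs_mul, abs_of_nonneg hν]
        _ ≤ K := add_le_add (hBb hR hτI) (mul_le_mul_of_nonneg_left (hEb hR hτI) hν)
    · refine Eventually.of_forall fun τ hτ => ?_
      rw [uIoc_of_le hst] at hτ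
      have hτI : τ ∈ Icc s t := ⟨hτ.1.le, hτ.2⟩
      have h := (hBlim hτI).sub ((hElim hτI).const_mul ν)
      rw [show 2 * P τ - 2 * M τ - ν * (2 * L) = -2 * M τ + 2 * P τ - 2 * ν * L by ring] at h
      exact h
  -- (6) conclusion
  have hLHS : Tendsto (fun R => N R t - N R s) atTop (𝓝 (M t - M s)) :=
    (hNlim ⟨hst, le_rfl⟩).sub (hNlim ⟨le_rfl, hst⟩)
  have hRHS : Tendsto (fun R => N R t - N R s) atTop (𝓝 (∫ τ in s..t, (-2 * M τ + 2 * P τ - 2 * ν * L))) := by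
    refine hInt.congr' ?_
    filter_upwards [eventually_gt_atTop 0] with R hR
    exact (hFTC R hR).symm
  exact tendsto_nhds_unique hLHS hRHS

end Solution

/-! ## The registered sub-goal -/

/-- **THE SECOND-MOMENT / REYNOLDS-STRESS LAW (registered sub-goal `secondMoment_law` of line `FirstLemmasR2K4`).**
Along every classical solution of the stretched layer class on `(0, ∞)` (`ν, L > 0`) with shear tails on compact
time intervals, the second `y`-moment of the vorticity over one period strip, `I₂(τ) = ∫_{x ∈ (0,L]} ∫_y y²ω(τ)`,
satisfies for `0 < s ≤ t` the exact law `I₂(t) − I₂(s) = ∫_s^t (−2I₂(τ) + 2Π(τ) − 2νL) dτ` with the Reynolds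
stress `Π(τ) = ∫_{x ∈ (0,L]} ∫_y u v`: `secondMoment_strip_law` and Fubini (`|y²ω| ≤ Cy²e^{−k|y|}`,
`|uv| ≤ (1 + C)Ce^{−k|y|}` are integrable on the strip). [folklore] -/
theorem secondMoment_law : ∀ (ν L : ℝ), 0 < ν → 0 < L → ∀ (u v p : ℝ → ℝ → ℝ → ℝ), IsStretchedLayerNSSolutionOn (Ioi 0) ν 1 1 L u v p → (∀ a b : ℝ, 0 < a → a < b → ExpTails (Icc a b) u v) → ∀ s t : ℝ, 0 < s → s ≤ t → (∫ x in Ioc 0 L, ∫ y, y ^ 2 * vorticity (u t) (v t) x y) - (∫ x in Ioc 0 L, ∫ y, y ^ 2 * vorticity (u s) (v s) x y) = ∫ τ in s..t, (-2 * (∫ x in Ioc 0 L, ∫ y, y ^ 2 * vorticity (u τ) (v τ) x y) + 2 * (∫ x in Ioc 0 L, ∫ y, u τ x y * v τ x y) - 2 * ν * L) := by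
  intro ν L hν hL u v p hsol htails s t hs hst
  obtain ⟨C, k, hk, hCk⟩ := htails (s / 2) (t + 1) (by positivity) (by linarith)
  have hST : ∀ τ ∈ Icc s t, SliceTails C k (u τ) (v τ) := fun τ hτ =>
    (hCk τ ⟨by linarith [hτ.1], by linarith [hτ.2]⟩).1
  have eM : ∀ τ ∈ Icc s t, (∫ x in Ioc 0 L, ∫ y, y ^ 2 * vorticity (u τ) (v τ) x y) =
      ∫ q in Ioc 0 L ×ˢ univ, q.2 ^ 2 * vorticity (u τ) (v τ) q.1 q.2 := fun τ hτ => by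
    have hτ0 : τ ∈ Ioi (0:ℝ) := hs.trans_le hτ.1
    exact integral_iterated_eq_strip (F := fun q : ℝ × ℝ => q.2 ^ 2 * vorticity (u τ) (v τ) q.1 q.2)
      (secondMoment_integrableOn_sqMoment hk (hST τ hτ) (hsol.contDiff_u hτ0) (hsol.contDiff_v hτ0))
  have eP : ∀ τ ∈ Icc s t, (∫ x in Ioc 0 L, ∫ y, u τ x y * v τ x y) =
      ∫ q in Ioc 0 L ×ˢ univ, u τ q.1 q.2 * v τ q.1 q.2 := fun τ hτ => by
    have hτ0 : τ ∈ Ioi (0:ℝ) := hs.trans_le hτ.1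
    have hT := hST τ hτ
    exact integral_iterated_eq_strip (F := fun q : ℝ × ℝ => u τ q.1 q.2 * v τ q.1 q.2)
      (integrableOn_strip_bdd_mul_decay hk (hsol.contDiff_u hτ0).continuous (hsol.contDiff_v hτ0).continuous
        (hT.abs_u_le hk) hT.nonneg hT.abs_v_le)
  rw [eM t ⟨hst, le_rfl⟩, eM s ⟨le_rfl, hst⟩, secondMoment_strip_law hν.le hL hsol htails hs hst]
  refine intervalIntegral.integral_congr fun τ hτ => ?_
  rw [uIcc_of_le hst] at hτ
  rw [eM τ hτ, eP τ hτ]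

end Summit.AnomalousDissipation.AnomalousDissipation.Theorems.StrainedLayerLaw.LogEnstrophyClock

end
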